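import Mathlib
import Literature.NumberTheory.LFunctions.Zhang2022.SkeletonPropositions
import HarnessLib

/-!
# Zhang (2022), programme F-S3 (cell landau-siegel, family B-det): the estimate row det-E10
# «E-det-Ψ₂» (registry E-097) — prime character sums over the EXCEPTIONAL set `Ψ₂`, as a predicate

Y. Zhang, *Discrete mean estimates and the Landau–Siegel zero*, arXiv:2211.02515v1
[Zhang2022LandauSiegel] — an unrefereed manuscript under adjudication. **WHAT THIS IS NOT: not a
claim about Theorems 1–2 of arXiv:2211.02515, about Landau–Siegel zeros, or about Parity; nothing
here asserts any claim of the manuscript, and nothing here asserts the estimate det-E10 — it is an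
OPEN row (expected XL) of the cell's registry, typed as a predicate with explicit parameters so that
a design can name it.** «The programme SEARCHES and TYPES; no claim about Landau–Siegel zeros,
Theorems 1–2 of arXiv:2211.02515 or a repaired Margin232 until a kernel theorem says so.»

Source of the row: the family planner's memo `B-det/plan/D6-DOOR.md` v1 (92c3b34ddaaa4cea) §1, §4
(X1–X4), §5; registry id E-097 (ls-obj-plan 19:53:07Z). The objects are the skeleton's: the family
`Chr D` of pairs `(p, ψ)` (`p ∼ P` prime, `ψ` primitive mod `p`), the centre `s₀` (`Skeleton.s0`,
height `t₀ = 𝓛⁵¹⁹`), `P = exp(𝓛⁹)` (`Skeleton.bigP`), and the exceptional set `Ψ₂` = the complement of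
`Ψ₁` (`Skeleton.PsiTwo`, Prop. 2.1: the characters on which the (A)-analysis of §3 is silent).

* `Det.primeCharSum Φ D x X` — `A_ψ(X) := Σ_{n ≤ 2X} Λ(n) ψ(n) Φ(n/X) n^{−s₀}` (a smooth prime
  character sum of length `X` at the height of the window; `Φ` a cutoff, in the memo smooth with
  compact support in `(1/2, 2)` — here any real function, the support being imposed by the range).
* `Det.diagPrime Φ X` — the diagonal `Σ_{n ≤ 2X} Λ(n)² Φ(n/X)² / n`; `Det.famCard D` — the number of
  pairs `(p, ψ)` in the family; `Det.doorLength D η′ = (P·t₀)^{1+η′}` — the length just beyond the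
  orthogonality range, in the memo's TRUE units (`ξ = log X / log(P t₀)`).
* **`Det.EdetPsi2 Φ η′ : Prop`** — det-E10 as printed in the memo §5: «under (A), for all large `D`,
  `Σ_{ψ ∈ Ψ₂} |A_ψ((P t₀)^{1+η′(D)})|² = o(η′(D))·N`», `N = famCard·diagPrime`, typed as
  «for every `ε > 0`, for all large `D`, (A) ⇒ LHS ≤ ε·η′(D)·N» with the rate `η′ : ℕ → ℝ` a NAMED
  parameter (the memo's window: `K c′π𝓛⁻⁸ ≤ η′ ≤ c𝓛^{−4.5}`). A predicate ON `(Φ, η′)` — stated,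
  never asserted; status open-in-print (nearest: GRH-quality pointwise bounds; large sieve short by
  `≥ 𝓛^{4.5}`, memo §4 X2).
* `Det.EdetPsi2.of_le` — API: the bound persists with any constant factor `c ≥ 1` on the right
  (a trivially proved unfolding lemma showing how a design consumes the row).

0 named facts, 0 sorries.

## References

* Y. Zhang, arXiv:2211.02515v1 (2022), §2 Prop. 2.1, §3 p. 7 (the sets `Ψ₁`, `Ψ₂`), (3.4)–(3.6).
  [cite: Zhang2022LandauSiegel, §2 Prop. 2.1, §3 p. 7]
* Cell documents (not literature): `B-det/plan/D6-DOOR.md` v1 §§1, 4, 5; `B-det/EDLIST.md` v1.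
-/

open Complex Real ComplexConjugate

noncomputable section

namespace Literature.NumberTheory.LFunctions.Zhang2022.Det

open Skeleton ArithmeticFunction

/-- **The smooth prime character sum `A_ψ(X) = Σ_{n ≤ 2X} Λ(n)ψ(n)Φ(n/X)n^{−s₀}`** at the height of the
window (`s₀ = ½ + 2πit₀`-type centre of the skeleton). [cite: Zhang2022LandauSiegel, §3 p. 7] -/
def primeCharSum (Φ : ℝ → ℝ) (D : ℕ) (x : Chr D) (X : ℝ) : ℂ :=
  ∑ n ∈ Finset.Icc 1 ⌊2 * X⌋₊,
    (vonMangoldt n : ℂ) * x.ψ (n : ZMod x.p) * (Φ (n / X) : ℂ) * (n : ℂ) ^ (-s0 D)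

/-- **The diagonal `Σ_{n ≤ 2X} Λ(n)²Φ(n/X)²/n`** (per character). [cite: Zhang2022LandauSiegel, §3 p. 7] -/
def diagPrime (Φ : ℝ → ℝ) (X : ℝ) : ℝ :=
  ∑ n ∈ Finset.Icc 1 ⌊2 * X⌋₊, vonMangoldt n ^ 2 * Φ (n / X) ^ 2 / n

/-- The number of pairs `(p, ψ)` in the family `Ψ` (`p ∼ P`, `ψ` primitive mod `p`).
[cite: Zhang2022LandauSiegel, §2 p. 4] -/
def famCard (D : ℕ) : ℕ := (finsetOf (Set.univ : Set (Chr D))).card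

/-- **The door length `(P·t₀)^{1+η′}`** — just beyond the orthogonality range in true units
(`ξ = log X / log(P t₀) = 1 + η′`). [cite: Zhang2022LandauSiegel, §2 p. 4] -/
def doorLength (D : ℕ) (η' : ℝ) : ℝ := (bigP D * t0 D) ^ (1 + η')

/-- **det-E10 «E-det-Ψ₂» (registry E-097) as a predicate**: under (A), for every `ε > 0` and all
large `D`, `Σ_{ψ ∈ Ψ₂} |A_ψ((P t₀)^{1+η′(D)})|² ≤ ε · η′(D) · (#Ψ · Σ_n Λ(n)²Φ(n/X)²/n)` — the
(A)-silent characters contribute `o(η′)` of the diagonal at the door length. OPEN (expected XL: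
pointwise GRH-quality cancellation on `Ψ₂`; the large sieve gives `O(1)`, short by `≥ 𝓛^{4.5}`);
stated, never asserted. [cite: Zhang2022LandauSiegel, §2 Prop. 2.1, §3 p. 7] -/
def EdetPsi2 (Φ : ℝ → ℝ) (η' : ℕ → ℝ) : Prop :=
  ∀ ε : ℝ, 0 < ε → ForAllLarge fun D _ χ => AssumptionA D χ →
    (∑ x ∈ finsetOf (PsiTwo χ), ‖primeCharSum Φ D x (doorLength D (η' D))‖ ^ 2) ≤
      ε * η' D * (famCard D * diagPrime Φ (doorLength D (η' D)))

/-- API: if det-E10 holds, its bound holds with any constant factor `c ≥ 1` on the right-hand side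
(how a design file consumes the row). [cite: Zhang2022LandauSiegel, §3 p. 7] -/
theorem EdetPsi2.of_le {Φ : ℝ → ℝ} {η' : ℕ → ℝ} (h : EdetPsi2 Φ η') {c : ℝ} (hc : 1 ≤ c)
    (ε : ℝ) (hε : 0 < ε) :
    ForAllLarge fun D _ χ => AssumptionA D χ →
      (∑ x ∈ finsetOf (PsiTwo χ), ‖primeCharSum Φ D x (doorLength D (η' D))‖ ^ 2) ≤
        c * ε * η' D * (famCard D * diagPrime Φ (doorLength D (η' D))) := by
  refine (h ε hε).mono fun D _ χ _ _ hD hA => (hD hA).trans ?_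
  have hnn : 0 ≤ ε * η' D * (famCard D * diagPrime Φ (doorLength D (η' D))) :=
    le_trans (Finset.sum_nonneg fun _ _ => by positivity) (hD hA)
  calc ε * η' D * (famCard D * diagPrime Φ (doorLength D (η' D)))
      = 1 * (ε * η' D * (famCard D * diagPrime Φ (doorLength D (η' D)))) := by ring
    _ ≤ c * (ε * η' D * (famCard D * diagPrime Φ (doorLength D (η' D)))) :=
        mul_le_mul_of_nonneg_right hc hnn
    _ = c * ε * η' D * (famCard D * diagPrime Φ (doorLength D (η' D))) := by ring

end Literature.NumberTheory.LFunctions.Zhang2022.Det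

end
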